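import Summits.QuantumFields.QCD.Theses.HeatSlicedQuarks
import Summits.QuantumFields.QCD.Theorems.HeatSlicedQuarksSmallFieldUltracontractivity
import Summits.QuantumFields.QCD.Theorems.HeatSlicedQuarksDaviesGaffneyWilson

/-!
# Stub `stub_offDiagLogProfile` of line `Sketch` (crux `InterleavedHeatSliceFlow`, item stmt-QuantumFields-8891)

The log-parabolic OFF-DIAGONAL profile of the Wilson quark heat kernel under GLOBAL scale-covariant
plaquette smallness (`OffDiagLogProfile` of the skeleton, written out): there are `ε > 0` and `C`
such that on every torus `T_L`, for every `SU(3)` field `U` with `3 - Re tr U_p ≤ (ε/r²)²` at EVERY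
plaquette (`1 ≤ r ≤ L`), every mass `m ∈ [-1/2, 1]` and every `1 ≤ t ≤ r²`,
`|e^{-t H_U}((x,a,α),(y,b,β))| ≤ C t⁻² (1 + d(x,y)²/(t (1 + log t)))⁻³`, with `H_U = D_Wᴴ D_W`,
`D_W = wilsonDirac (fundamentalRep (Fin 3)) U m 1` and `d = torusDist x y`.

Proof.  Two LANDED theorems are combined by a case split of `d²` against the log-parabolic scale
`s = t (1 + log t)` (threshold `(8/c) s`, `c` the Davies–Gaffney rate):
* NEAR (`d² ≤ (8/c) s`): the closed crux 8871
  (`Cruxes.SmallFieldUltracontractivity.PointCentredAxialParabolic.SmallFieldUltracontractivity_of`)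
  bounds every DIAGONAL entry by `C₀/t²` (global smallness implies smallness on every `K·r`-ball),
  and the PSD domination `|K(i,j)|² ≤ Re K(i,i) · Re K(j,j)`
  (`Theorems.SmallFieldUltracontractivity.Negative.norm_sq_exp_neg_smul_apply_le`; `Re K(i,i) ≥ 0`
  by `exp_neg_smul_apply_self_eq_sum_norm_sq`) extends this to ALL entries; the profile factor is
  `≥ (1 + 8/c)⁻³` in this regime.
* FAR (`d² > (8/c) s`): the closed support 8873 (`Theorems.DaviesGaffneyWilson_proof`,
  `|K| ≤ C₁ e^{-c d²/(t+d)}` for `m ∈ [-1,1] ⊇ [-1/2,1]`, `t ≥ 0`).  For `d ≤ t`,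
  `d²/(t+d) ≥ d²/(2t)` and `e^{-c d²/(2t)}` is the product of `e^{-c d²/(4t)} ≤ e^{-2(1+log t)} ≤ t⁻²`
  and `e^{-c d²/(4t)} ≤ e^{-(c/4) u} ≤ (12/c)³ e^{c/4} (1+u)⁻³` (`u = d²/s ≤ d²/t`); for `d > t ≥ 1`,
  `d²/(t+d) ≥ d/2`, `d⁸ e^{-c d/2} ≤ (16/c)⁸` and `t² (1+u)³ ≤ 8 d⁸`.
The polynomial-versus-exponential comparisons all come from `y ≤ k⁻¹ e^{k y}`
(`Real.add_one_le_exp`); besides that only `Real.exp_log`, monotonicity of `exp` and field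
arithmetic are used.  Final constant: `C = C₀⁺ (1 + 8/c)³ + C₁⁺ ((12/c)³ e^{c/4} + 8 (16/c)⁸)`.
-/

namespace Summit.QuantumFields.QCD.Cruxes.InterleavedHeatSliceFlow.Sketch

open Literature.MathematicalPhysics.QuantumLattice Literature.MathematicalPhysics.QuantumFieldTheory
  Literature.Probability.LatticeModels
open Summit.QuantumFields.QCD.Theses.HeatSlicedQuarks
open scoped Matrix

/-! ### Elementary real inequalities: polynomials against exponentials -/

/-- Linear growth is beaten by exponential growth: `y ≤ k⁻¹ e^{k y}` for `k > 0` (from `x + 1 ≤ eˣ`). -/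
theorem offDiag_le_inv_mul_exp {k : ℝ} (hk : 0 < k) (y : ℝ) : y ≤ k⁻¹ * Real.exp (k * y) := by
  rw [le_inv_mul_iff₀ hk]
  linarith [Real.add_one_le_exp (k * y)]

/-- Cubic growth is beaten by exponential growth: `e^{-k u} ≤ (3/k)³ eᵏ (1+u)⁻³` for `u ≥ 0`,
`k > 0`. -/
theorem offDiag_exp_neg_le_inv_cube {k u : ℝ} (hk : 0 < k) (hu : 0 ≤ u) :
    Real.exp (-(k * u)) ≤ (3 / k) ^ 3 * Real.exp k * ((1 + u) ^ 3)⁻¹ := by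
  have hk3 : 0 < k / 3 := by positivity
  have h1u : 0 < 1 + u := by positivity
  have h3 : (1 + u) ^ 3 ≤ ((k / 3)⁻¹ * Real.exp (k / 3 * (1 + u))) ^ 3 :=
    pow_le_pow_left₀ h1u.le (offDiag_le_inv_mul_exp hk3 (1 + u)) 3
  have harg : ((3 : ℕ) : ℝ) * (k / 3 * (1 + u)) = k + k * u := by
    push_cast
    ring
  have hexp : ((k / 3)⁻¹ * Real.exp (k / 3 * (1 + u))) ^ 3 =
      (3 / k) ^ 3 * Real.exp k * Real.exp (k * u) := by
    rw [mul_pow, ← Real.exp_nat_mul, harg, Real.exp_add, inv_div, mul_assoc]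
  rw [hexp] at h3
  rw [← div_eq_mul_inv, le_div_iff₀ (pow_pos h1u 3)]
  calc Real.exp (-(k * u)) * (1 + u) ^ 3
      ≤ Real.exp (-(k * u)) * ((3 / k) ^ 3 * Real.exp k * Real.exp (k * u)) :=
        mul_le_mul_of_nonneg_left h3 (Real.exp_pos _).le
    _ = (3 / k) ^ 3 * Real.exp k * (Real.exp (k * u) * Real.exp (-(k * u))) := by ring
    _ = (3 / k) ^ 3 * Real.exp k := by
        rw [Real.exp_neg, mul_inv_cancel₀ (Real.exp_pos _).ne', mul_one]

/-- Octic growth is beaten by exponential growth: `d⁸ e^{-k d} ≤ (8/k)⁸` for `d ≥ 0`, `k > 0`. -/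
theorem offDiag_pow_eight_mul_exp_neg_le {k d : ℝ} (hk : 0 < k) (hd : 0 ≤ d) :
    d ^ 8 * Real.exp (-(k * d)) ≤ (8 / k) ^ 8 := by
  have hk8 : 0 < k / 8 := by positivity
  have h8 : d ^ 8 ≤ ((k / 8)⁻¹ * Real.exp (k / 8 * d)) ^ 8 :=
    pow_le_pow_left₀ hd (offDiag_le_inv_mul_exp hk8 d) 8
  have harg : ((8 : ℕ) : ℝ) * (k / 8 * d) = k * d := by
    push_cast
    ring
  have hexp : ((k / 8)⁻¹ * Real.exp (k / 8 * d)) ^ 8 = (8 / k) ^ 8 * Real.exp (k * d) := by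
    rw [mul_pow, ← Real.exp_nat_mul, harg, inv_div]
  rw [hexp] at h8
  calc d ^ 8 * Real.exp (-(k * d)) ≤ (8 / k) ^ 8 * Real.exp (k * d) * Real.exp (-(k * d)) :=
        mul_le_mul_of_nonneg_right h8 (Real.exp_pos _).le
    _ = (8 / k) ^ 8 := by
        rw [Real.exp_neg, mul_assoc, mul_inv_cancel₀ (Real.exp_pos _).ne', mul_one]

/-- `e^{-2(1 + log t)} ≤ t⁻²` for `t ≥ 1` (indeed it equals `e^{-2} t⁻²`). -/
theorem offDiag_exp_neg_two_mul_le {t : ℝ} (ht : 1 ≤ t) :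
    Real.exp (-(2 * (1 + Real.log t))) ≤ (t ^ 2)⁻¹ := by
  have ht0 : 0 < t := by linarith
  have h : Real.exp (2 * Real.log t) = t ^ 2 := by
    rw [two_mul, Real.exp_add, Real.exp_log ht0, sq]
  rw [← h, ← Real.exp_neg]
  exact Real.exp_le_exp.2 (by linarith)

/-- FAR regime: for `c > 0`, `1 ≤ t`, `0 ≤ d` and `(8/c) · t (1 + log t) < d²`, the Davies–Gaffney
profile is below the log-parabolic one,
`e^{-c d²/(t+d)} ≤ C_far t⁻² (1 + d²/(t (1 + log t)))⁻³` with `C_far = (12/c)³ e^{c/4} + 8 (16/c)⁸`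
(Gaussian sub-regime `d ≤ t`, Poisson sub-regime `d > t`; see the module docstring). -/
theorem offDiag_far {c t d : ℝ} (hc : 0 < c) (ht : 1 ≤ t) (hd : 0 ≤ d)
    (hfar : 8 / c * (t * (1 + Real.log t)) < d ^ 2) :
    Real.exp (-(c * d ^ 2 / (t + d))) ≤
      ((12 / c) ^ 3 * Real.exp (c / 4) + 8 * (16 / c) ^ 8) / t ^ 2 *
        ((1 + d ^ 2 / (t * (1 + Real.log t))) ^ 3)⁻¹ := by
  have hlog : 0 ≤ Real.log t := Real.log_nonneg ht
  have ht0 : 0 < t := by linarith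
  -- abbreviations: `ℓ = 1 + log t ≥ 1`, `u = d² / (t ℓ) ≥ 0`
  obtain ⟨ℓ, hℓ⟩ : ∃ ℓ : ℝ, ℓ = 1 + Real.log t := ⟨_, rfl⟩
  rw [← hℓ] at hfar ⊢
  have hℓ1 : 1 ≤ ℓ := by rw [hℓ]; linarith
  have htℓ : t ≤ t * ℓ := le_mul_of_one_le_right ht0.le hℓ1
  have htℓ1 : 1 ≤ t * ℓ := ht.trans htℓ
  obtain ⟨u, hu⟩ : ∃ u : ℝ, u = d ^ 2 / (t * ℓ) := ⟨_, rfl⟩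
  rw [← hu]
  have hu0 : 0 ≤ u := by rw [hu]; positivity
  have hCp : 0 ≤ (12 / c) ^ 3 * Real.exp (c / 4) := by positivity
  have hCq : (0 : ℝ) ≤ 8 * (16 / c) ^ 8 := by positivity
  have h8 : 8 * (t * ℓ) < c * d ^ 2 := by
    rw [div_mul_eq_mul_div, div_lt_iff₀ hc] at hfar
    linarith
  rcases le_or_gt d t with hdt | htd
  · -- Gaussian sub-regime `d ≤ t`: `d²/(t+d) ≥ d²/(2t)`; split `e^{-c d²/(2t)}` into two quarters
    have h2t : c * d ^ 2 / (2 * t) ≤ c * d ^ 2 / (t + d) :=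
      div_le_div_of_nonneg_left (by positivity) (by positivity) (by linarith)
    have hq1 : Real.exp (-(c * d ^ 2 / (4 * t))) ≤ (t ^ 2)⁻¹ := by
      refine (Real.exp_le_exp.2 ?_).trans (offDiag_exp_neg_two_mul_le ht)
      rw [neg_le_neg_iff, le_div_iff₀ (by positivity), ← hℓ]
      linarith
    have hq2 : Real.exp (-(c * d ^ 2 / (4 * t))) ≤
        (12 / c) ^ 3 * Real.exp (c / 4) * ((1 + u) ^ 3)⁻¹ := by
      have hk : (0 : ℝ) < c / 4 := by positivity
      have hcube := offDiag_exp_neg_le_inv_cube hk hu0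
      have h12 : (3 / (c / 4) : ℝ) = 12 / c := by
        rw [div_div_eq_mul_div]
        norm_num
      rw [h12] at hcube
      refine (Real.exp_le_exp.2 ?_).trans hcube
      rw [neg_le_neg_iff]
      calc c / 4 * u = c * d ^ 2 / (4 * (t * ℓ)) := by rw [hu]; ring
        _ ≤ c * d ^ 2 / (4 * t) :=
            div_le_div_of_nonneg_left (by positivity) (by positivity) (by linarith)
    calc Real.exp (-(c * d ^ 2 / (t + d)))
        ≤ Real.exp (-(c * d ^ 2 / (2 * t))) := Real.exp_le_exp.2 (neg_le_neg h2t)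
      _ = Real.exp (-(c * d ^ 2 / (4 * t))) * Real.exp (-(c * d ^ 2 / (4 * t))) := by
          rw [← Real.exp_add]
          congr 1
          ring
      _ ≤ (t ^ 2)⁻¹ * ((12 / c) ^ 3 * Real.exp (c / 4) * ((1 + u) ^ 3)⁻¹) :=
          mul_le_mul hq1 hq2 (Real.exp_pos _).le (by positivity)
      _ = (12 / c) ^ 3 * Real.exp (c / 4) / t ^ 2 * ((1 + u) ^ 3)⁻¹ := by ring
      _ ≤ _ := by
          gcongr
          exact le_add_of_nonneg_right hCq
  · -- Poisson sub-regime `t < d`: `d²/(t+d) ≥ d/2`, `d⁸ e^{-c d/2} ≤ (16/c)⁸`, `t² (1+u)³ ≤ 8 d⁸`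
    have hd0 : 0 < d := ht0.trans htd
    have hd1 : 1 ≤ d ^ 2 := one_le_pow₀ (ht.trans htd.le)
    have h2d : c * d / 2 ≤ c * d ^ 2 / (t + d) := by
      rw [div_le_div_iff₀ (by norm_num) (by positivity)]
      nlinarith [mul_pos hc hd0]
    have hu1 : 1 + u ≤ 2 * d ^ 2 := by
      have : u ≤ d ^ 2 := by rw [hu]; exact div_le_self (sq_nonneg d) htℓ1
      linarith
    have hpoly : t ^ 2 * (1 + u) ^ 3 ≤ 8 * d ^ 8 := by
      have h1 : t ^ 2 ≤ d ^ 2 := pow_le_pow_left₀ ht0.le htd.le 2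
      have h2 : (1 + u) ^ 3 ≤ (2 * d ^ 2) ^ 3 := pow_le_pow_left₀ (by positivity) hu1 3
      calc t ^ 2 * (1 + u) ^ 3 ≤ d ^ 2 * (2 * d ^ 2) ^ 3 :=
            mul_le_mul h1 h2 (by positivity) (by positivity)
        _ = 8 * d ^ 8 := by ring
    have hexp8 : d ^ 8 * Real.exp (-(c * d / 2)) ≤ (16 / c) ^ 8 := by
      have hk : (0 : ℝ) < c / 2 := by positivity
      have h := offDiag_pow_eight_mul_exp_neg_le hk hd
      have h16 : (8 / (c / 2) : ℝ) = 16 / c := by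
        rw [div_div_eq_mul_div]
        norm_num
      have harg : c / 2 * d = c * d / 2 := by ring
      rwa [h16, harg] at h
    have hX : t ^ 2 * (1 + u) ^ 3 ≠ 0 := by positivity
    calc Real.exp (-(c * d ^ 2 / (t + d)))
        ≤ Real.exp (-(c * d / 2)) := Real.exp_le_exp.2 (neg_le_neg h2d)
      _ = Real.exp (-(c * d / 2)) * (t ^ 2 * (1 + u) ^ 3) * (t ^ 2 * (1 + u) ^ 3)⁻¹ := by
          rw [mul_assoc, mul_inv_cancel₀ hX, mul_one]
      _ ≤ Real.exp (-(c * d / 2)) * (8 * d ^ 8) * (t ^ 2 * (1 + u) ^ 3)⁻¹ := by gcongr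
      _ = 8 * (d ^ 8 * Real.exp (-(c * d / 2))) * (t ^ 2 * (1 + u) ^ 3)⁻¹ := by ring
      _ ≤ 8 * (16 / c) ^ 8 * (t ^ 2 * (1 + u) ^ 3)⁻¹ := by gcongr
      _ = 8 * (16 / c) ^ 8 / t ^ 2 * ((1 + u) ^ 3)⁻¹ := by
          rw [mul_inv]
          ring
      _ ≤ _ := by
          gcongr
          exact le_add_of_nonneg_left hCp

/-- Assembly of the two regimes: an entry bounded both by `M₀/t²` (near-diagonal input) and by
`M₁ e^{-c d²/(t+d)}` (Davies–Gaffney input) is bounded by the log-parabolic profile with constant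
`M₀ (1 + 8/c)³ + M₁ C_far`. -/
theorem offDiag_combine {c M₀ M₁ κ t d : ℝ} (hc : 0 < c) (ht : 1 ≤ t) (hd : 0 ≤ d)
    (hM₀ : 0 ≤ M₀) (hM₁ : 0 ≤ M₁)
    (hnear : κ ≤ M₀ / t ^ 2) (hfarb : κ ≤ M₁ * Real.exp (-(c * d ^ 2 / (t + d)))) :
    κ ≤ (M₀ * (1 + 8 / c) ^ 3 + M₁ * ((12 / c) ^ 3 * Real.exp (c / 4) + 8 * (16 / c) ^ 8)) / t ^ 2 *
      ((1 + d ^ 2 / (t * (1 + Real.log t))) ^ 3)⁻¹ := by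
  have ht0 : 0 < t := by linarith
  have hℓ1 : 1 ≤ 1 + Real.log t := by linarith [Real.log_nonneg ht]
  have hP0 : 0 < ((1 + d ^ 2 / (t * (1 + Real.log t))) ^ 3)⁻¹ := by positivity
  have hA0 : (0 : ℝ) < 8 / c := by positivity
  have hCfar : 0 ≤ (12 / c) ^ 3 * Real.exp (c / 4) + 8 * (16 / c) ^ 8 := by positivity
  rw [add_div, add_mul]
  rcases le_or_gt (d ^ 2) (8 / c * (t * (1 + Real.log t))) with hnear' | hfar
  · -- near regime: the profile factor is at least `(1 + 8/c)⁻³`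
    have hu : d ^ 2 / (t * (1 + Real.log t)) ≤ 8 / c := by
      rwa [div_le_iff₀ (by positivity)]
    have hA3 : (1 + 8 / c) ^ 3 ≠ 0 := by positivity
    calc κ ≤ M₀ / t ^ 2 := hnear
      _ = M₀ * (1 + 8 / c) ^ 3 / t ^ 2 * ((1 + 8 / c) ^ 3)⁻¹ := by
          rw [mul_div_right_comm, mul_assoc, mul_inv_cancel₀ hA3, mul_one]
      _ ≤ M₀ * (1 + 8 / c) ^ 3 / t ^ 2 * ((1 + d ^ 2 / (t * (1 + Real.log t))) ^ 3)⁻¹ := by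
          gcongr
      _ ≤ _ := le_add_of_nonneg_right (by positivity)
  · -- far regime
    calc κ ≤ M₁ * Real.exp (-(c * d ^ 2 / (t + d))) := hfarb
      _ ≤ M₁ * (((12 / c) ^ 3 * Real.exp (c / 4) + 8 * (16 / c) ^ 8) / t ^ 2 *
            ((1 + d ^ 2 / (t * (1 + Real.log t))) ^ 3)⁻¹) :=
          mul_le_mul_of_nonneg_left (offDiag_far hc ht hd hfar) hM₁
      _ = M₁ * ((12 / c) ^ 3 * Real.exp (c / 4) + 8 * (16 / c) ^ 8) / t ^ 2 *
            ((1 + d ^ 2 / (t * (1 + Real.log t))) ^ 3)⁻¹ := by ring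
      _ ≤ _ := le_add_of_nonneg_left (by positivity)

/-! ### The stub -/

/-- **Stub `stub_offDiagLogProfile`** (M; reshape r4; worker): `OffDiagLogProfile` written out — under
GLOBAL `(ε/r²)²`-smallness of the plaquette deficits, for `1 ≤ t ≤ r²`, every entry of the heat kernel
of `H_U = D_Wᴴ D_W` obeys `|e^{-tH_U}((x,a,α),(y,b,β))| ≤ C t⁻² (1 + d(x,y)²/(t(1 + log t)))⁻³`.
Proof: `ε, K, C₀` from the landed crux 8871 (`SmallFieldUltracontractivity_of`; global smallness ⇒
smallness on every `K·r`-ball ⇒ diagonal `≤ C₀/t²` at `x` AND at `y`), PSD domination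
`|K(i,j)|² ≤ Re K(i,i) Re K(j,j)` (`norm_sq_exp_neg_smul_apply_le`) ⇒ `|K(i,j)| ≤ C₀⁺/t²` for all
entries; `C₁, c` from the landed support 8873 (`DaviesGaffneyWilson_proof`); the two are combined by
`offDiag_combine` (near: `d² ≤ (8/c) t(1+log t)`; far: `offDiag_far`).  Constant
`C = C₀⁺ (1 + 8/c)³ + C₁⁺ ((12/c)³ e^{c/4} + 8 (16/c)⁸)`, `C⁺ = max C 0`. -/
theorem stub_offDiagLogProfile :
    ∃ ε : ℝ, 0 < ε ∧ ∃ C : ℝ, ∀ (L : ℕ) [NeZero L]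
      (U : GaugeConfig 4 L (Matrix.specialUnitaryGroup (Fin 3) ℂ)) (m : ℝ), m ∈ Set.Icc (-(1 / 2 : ℝ)) 1 →
      ∀ (r : ℕ), 1 ≤ r → r ≤ L →
      (∀ (y : TorusSite 4 L) (μ ν : Fin 4),
        3 - ((fundamentalRep (Fin 3)) (plaquetteHolonomy U y μ ν)).trace.re ≤ (ε / (r : ℝ) ^ 2) ^ 2) →
      ∀ (t : ℝ), 1 ≤ t → t ≤ (r : ℝ) ^ 2 → ∀ (x y : TorusSite 4 L) (a b : Fin 3) (α β : Fin 4),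
        ‖(NormedSpace.exp (-(t : ℂ) • ((wilsonDirac (fundamentalRep (Fin 3)) U m 1)ᴴ *
              wilsonDirac (fundamentalRep (Fin 3)) U m 1))) (x, a, α) (y, b, β)‖ ≤
          C / t ^ 2 * ((1 + (torusDist x y : ℝ) ^ 2 / (t * (1 + Real.log t))) ^ 3)⁻¹ := by
  obtain ⟨ε, hε, K, C₀, hC₀⟩ :=
    (Cruxes.SmallFieldUltracontractivity.PointCentredAxialParabolic.SmallFieldUltracontractivity_of :
      SmallFieldUltracontractivity)
  obtain ⟨C₁, c, hc, hC₁⟩ :=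
    (Summit.QuantumFields.QCD.Theorems.DaviesGaffneyWilson_proof : DaviesGaffneyWilson)
  refine ⟨ε, hε, max C₀ 0 * (1 + 8 / c) ^ 3 +
    max C₁ 0 * ((12 / c) ^ 3 * Real.exp (c / 4) + 8 * (16 / c) ^ 8), ?_⟩
  intro L _ U m hm r hr hrL hsmall t ht htr x y a b α β
  have ht0 : 0 < t := by linarith
  -- diagonal entries: 8871 under global smallness (smallness on every `K·r`-ball)
  have hdiag : ∀ (z : TorusSite 4 L) (e : Fin 3) (γ : Fin 4),
      ((NormedSpace.exp (-(t : ℂ) • ((wilsonDirac (fundamentalRep (Fin 3)) U m 1)ᴴ *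
          wilsonDirac (fundamentalRep (Fin 3)) U m 1))) (z, e, γ) (z, e, γ)).re ≤ max C₀ 0 / t ^ 2 := by
    intro z e γ
    refine (Complex.re_le_norm _).trans
      ((hC₀ L U m hm z r hr hrL (fun w _ μ ν => hsmall w μ ν) t ht htr e e γ γ).trans ?_)
    gcongr
    exact le_max_left _ _
  -- diagonal entries have nonnegative real part (T*T identity)
  have hre0 : ∀ i : TorusSite 4 L × Fin 3 × Fin 4,
      0 ≤ ((NormedSpace.exp (-(t : ℂ) • ((wilsonDirac (fundamentalRep (Fin 3)) U m 1)ᴴ *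
          wilsonDirac (fundamentalRep (Fin 3)) U m 1))) i i).re := by
    intro i
    rw [Theorems.SmallFieldUltracontractivity.Negative.exp_neg_smul_apply_self_eq_sum_norm_sq]
    simp only [Complex.re_sum, Complex.ofReal_re]
    positivity
  -- PSD domination: every entry is bounded by `C₀⁺/t²`
  have hnear : ‖(NormedSpace.exp (-(t : ℂ) • ((wilsonDirac (fundamentalRep (Fin 3)) U m 1)ᴴ *
        wilsonDirac (fundamentalRep (Fin 3)) U m 1))) (x, a, α) (y, b, β)‖ ≤ max C₀ 0 / t ^ 2 := by
    have hM : 0 ≤ max C₀ 0 / t ^ 2 := by positivity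
    refine (sq_le_sq₀ (norm_nonneg _) hM).1 ?_
    calc _ ≤ _ := Theorems.SmallFieldUltracontractivity.Negative.norm_sq_exp_neg_smul_apply_le
          (wilsonDirac (fundamentalRep (Fin 3)) U m 1) t (x, a, α) (y, b, β)
      _ ≤ (max C₀ 0 / t ^ 2) * (max C₀ 0 / t ^ 2) :=
          mul_le_mul (hdiag x a α) (hdiag y b β) (hre0 _) hM
      _ = (max C₀ 0 / t ^ 2) ^ 2 := (sq _).symm
  -- Davies–Gaffney (8873), `m ∈ [-1/2, 1] ⊆ [-1, 1]`, `t ≥ 0`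
  have hfarb := hC₁ L U m ⟨by linarith [hm.1], hm.2⟩ t ht0.le x y a b α β
  exact offDiag_combine hc ht (Nat.cast_nonneg _) (le_max_right _ _) (le_max_right _ _) hnear
    (hfarb.trans (mul_le_mul_of_nonneg_right (le_max_left _ _) (Real.exp_pos _).le))

end Summit.QuantumFields.QCD.Cruxes.InterleavedHeatSliceFlow.Sketch
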